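import Summits.BirchSwinnertonDyer.BirchSwinnertonDyer.Theorems.SignedBaseChangeAnticyclotomicEisensteinDivisibilityAdmdefHowardRigidityRoot
import Summits.BirchSwinnertonDyer.BirchSwinnertonDyer.Theorems.SignedBaseChangeAnticyclotomicEisensteinDivisibilityAdmdefRamifiedBaseChange
import HarnessLib

/-!
# Line `admdef` (crux `AnticyclotomicEisensteinDivisibility`, stmt-BirchSwinnertonDyer-20727), rigidity road — ASSEMBLY on the ALL-RAMIFIED cell:
# Howard's criterion at the ROOT modulo `𝔪` with (RAM) discharged from the line's binder (ii), conditional only on the `±` control (CTRL)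

LEAD seat bsd-line-sbc-p1 (gen 28), `--supports stmt-BirchSwinnertonDyer-20727` (helper; OFF the v23 composition path).  `…AdmdefHowardRigidityRoot`
(Howard 2006 Thm. 3.2.3 (c) at the root mod `𝔪` for CHKLL25's signed bipartite systems: `B.HasUnitLambda N` + (CTRL) + (RAM) + «`Sel^ε_1(K_0, E[p])`
is a line» ⟹ `z_{0,1} ≠ 0`) composed with `…AdmdefRamifiedBaseChange.forall_exists_inertia_smul_ne_baseChange_of_allRamified` ((RAM) for `E/K`
from the `ℚ`-side binder (ii) «`E[p]` ramified at every `q ∣ N`» of C⁺⁺ ∕ CHKLL25 Thm. 7.1 (ii), given `(N, d_K) = 1` and `[K : ℚ] = 2`).  RESULT: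
on the line's all-ramified cell (binder (ii); it contains bsd-idea-14's cell α by `…AdmdefRamifiedNS.allRamified_of_allAdditive`) Howard's
criterion at the root mod `𝔪` is in kernel CONDITIONAL ONLY on
  (CTRL) the layer-0 signed condition at `v ∣ p` implies the Kummer condition (B.-D. Kim 2007 Prop. 4.18 ∕ Hatley–Lei–Vigni 2022 Lemma 3.7,
         local form; the tree types the GLOBAL form `AcSigned.hatleyLeiVigni2022_lemma37_signedSelmerTorsion_zero` and the local CARDINALITY
         `AcSigned.hatleyLeiVigni2022_lemma38_card_localCondTorsion`, neither of which is the semi-local containment used here — a bridge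
         `condAboveTorsion ↔ localCondTorsion` is not in the tree), and
  the rank-one hypothesis «`Sel^ε_1(K_0, E[p])` is a line» in CHKLL25 currency.
Both theorems below are the two theorems of `…AdmdefHowardRigidityRoot` with `hram` replaced by `(N, d_K) = 1` + binder (ii).

HONEST FRAMING: theorems only (no definition, no named fact, no `sorry`); (CTRL) is a HYPOTHESIS; nothing about the crux, the anchors (K1) or BSD is
asserted.

References: [cite: Howard2006, Thm. 3.2.3 (c)] [cite: CastellaEtAl2025, Thm. 7.1 (ii), Thm. 7.5 (arXiv:2308.10474v2 pp. 29–31)]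
[cite: NeukirchANT1999, Ch. I §9 Prop. (9.4)] [cite: HatleyLeiVigni2022, Lemma 3.7] [cite: BDKim2013, Def. 3.5, §3].
-/

-- D-0017: single-problem summit, the namespace repeats the problem name by design.
set_option linter.dupNamespace false
set_option autoImplicit false

noncomputable section

open scoped Classical NumberField Pointwise

namespace Summit.BirchSwinnertonDyer.BirchSwinnertonDyer.Theorems.SignedBaseChangeAcDivAdmdefHowardRigidityRootAllRamified

open WeierstrassCurve NumberField IsDedekindDomain Field
open Literature.NumberTheory.EllipticCurves Literature.NumberTheory.GaloisRepresentations
open Literature.NumberTheory.EllipticCurves.CastellaHsuKunduLeeLiu2025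
open Literature.NumberTheory.EllipticCurves.BertoliniDarmon2005
open Literature.NumberTheory.EllipticCurves.AcSigned
open Summit.BirchSwinnertonDyer.BirchSwinnertonDyer.Theorems.AdditiveKoly
open Summit.BirchSwinnertonDyer.BirchSwinnertonDyer.Theorems.SignedBaseChangeAcDivAdmdefCoreRootOfSeenAnchor
open Summit.BirchSwinnertonDyer.BirchSwinnertonDyer.Theorems.SignedBaseChangeAcDivAdmdefHowardRigidityRoot
open Summit.BirchSwinnertonDyer.BirchSwinnertonDyer.Theorems.SignedBaseChangeAcDivAdmdefRamifiedBaseChange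

universe u

variable {K : Type} [Field K] [NumberField K] {W : WeierstrassCurve ℚ} [W.IsElliptic] [W.IsGloballyMinimal] {p : ℕ} [Fact p.Prime]
  {κ : ZpExtension K p} {γ : absoluteGaloisGroup K} {N : ℕ} {ε : ℤˣ} {B : SignedBipartiteSystem W K p κ}

/-- **Howard's criterion at the root, bottom layer, `κ` form, on the all-ramified cell** — unit `λ_1(n₀)(0)` at some `n₀ ∈ 𝒩_1^def` + (CTRL) +
`(N, d_K) = 1` + binder (ii) «`E[p]` ramified at every `q ∣ N`» + rank-one bottom signed Selmer line ⟹ `κ_1(1)_0 ≠ 0`.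
(`…HowardRigidityRoot.kappa_one_layer_zero_ne_zero_of_isUnit_lam` with (RAM) supplied by `…RamifiedBaseChange`.)
[cite: Howard2006, Thm. 3.2.3 (c)] [cite: CastellaEtAl2025, Thm. 7.1 (ii), Thm. 7.5 (arXiv:2308.10474v2 pp. 29–31)] -/
theorem kappa_one_layer_zero_ne_zero_of_isUnit_lam_of_allRamified (hB : IsSignedBipartiteSystem W K p κ γ N ε B)
    (hN : (N : ℤ) = W.conductorNorm ℤ) (h5 : 5 ≤ p) (hsurj : W.HasSurjectiveModNGaloisRep p) (hK : IsImaginaryQuadratic K)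
    (hH : SatisfiesHeegnerHypothesis (W.conductorNorm ℤ) K) (hsp : ((Ideal.span {(p : ℤ)}).primesOver (𝓞 K)).ncard = 2)
    (hND : IsCoprime (N : ℤ) (NumberField.discr K)) (hκ : κ.IsAnticyclotomic)
    (hctrl : ∀ v : HeightOneSpectrum (𝓞 K), ((p : ℕ) : 𝓞 K) ∈ v.asIdeal → ∀ X : Vp W K p,
      resH1Hom (Literature.NumberTheory.EllipticCurves.subgroupIncl (κ.layerSubgroup 0))
          (AddSubgroup.inclusion (geomTorsion_natCast_pow_one W (K := K) (p := p)).le) (fun _ _ ↦ rfl) X ∈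
        condAboveTorsion (W.baseChange K) p κ v (.sgn ε) 0 1 →
      X ∈ selmerLocalKer (W.baseChange K) (v.adicCompletion K) ((p ^ 1 : ℕ) : ℤ))
    (hall : ∀ q : ℕ, q.Prime → q ∣ N → ∃ v' : HeightOneSpectrum (𝓞 ℚ), ((q : ℕ) : 𝓞 ℚ) ∈ v'.asIdeal ∧
      ∃ 𝔓 ∈ v'.primesAbove, ∃ σ ∈ 𝔓.inertia (absoluteGaloisGroup ℚ), ∃ P : W.geomTorsion (p : ℤ), σ • P ≠ P)
    {s : (W.baseChange K).torsionH1Over ((p : ℤ) ^ 1) (κ.layerSubgroup 0)}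
    (hs : s ∈ signedOrdSelmerTorsion (W.baseChange K) p κ ε 1 0 1) (hs0 : s ≠ 0)
    (hline : ∀ c ∈ signedOrdSelmerTorsion (W.baseChange K) p κ ε 1 0 1, ∃ a : ℤ, c = a • s)
    {n₀ : ℕ} (hn₀ : n₀ ∈ defProducts N K (fun ℓ ↦ W.frobeniusTrace ℓ) p 1)
    (hlam : IsUnit (PowerSeries.constantCoeff (B.lam 1 n₀))) : B.kappa 1 1 0 ≠ 0 :=
  kappa_one_layer_zero_ne_zero_of_isUnit_lam hB hN h5 hsurj hK hH hsp hκ hctrl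
    (forall_exists_inertia_smul_ne_baseChange_of_allRamified W hK.1 hN hND hall) hs hs0 hline hn₀ hlam

/-- **Howard's criterion at the root modulo `𝔪` on the all-ramified cell, in kernel modulo the `±` control** — `B.HasUnitLambda N` + (CTRL) +
`(N, d_K) = 1` + binder (ii) «`E[p]` ramified at every `q ∣ N`» + rank-one bottom signed Selmer line ⟹ `z_{0,1} ≠ 0` for the limit base class `z` of
`B`.  (`…HowardRigidityRoot.limitBaseClass_layer_zero_one_ne_zero_of_hasUnitLambda` with (RAM) supplied by `…RamifiedBaseChange`.)
[cite: Howard2006, Thm. 3.2.3 (c)] [cite: BurungaleCastellaKim2021, arXiv:1908.09512 Prop. 7.4] [cite: CastellaEtAl2025, Thm. 7.1 (ii), Thm. 7.5] -/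
theorem limitBaseClass_layer_zero_one_ne_zero_of_hasUnitLambda_of_allRamified (hB : IsSignedBipartiteSystem W K p κ γ N ε B)
    {z : Π n j : ℕ, (W.baseChange K).torsionH1Over ((p : ℤ) ^ j) (κ.layerSubgroup n)} (hz : B.IsLimitBaseClass z)
    (hN : (N : ℤ) = W.conductorNorm ℤ) (h5 : 5 ≤ p) (hsurj : W.HasSurjectiveModNGaloisRep p) (hK : IsImaginaryQuadratic K)
    (hH : SatisfiesHeegnerHypothesis (W.conductorNorm ℤ) K) (hsp : ((Ideal.span {(p : ℤ)}).primesOver (𝓞 K)).ncard = 2)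
    (hND : IsCoprime (N : ℤ) (NumberField.discr K)) (hκ : κ.IsAnticyclotomic)
    (hctrl : ∀ v : HeightOneSpectrum (𝓞 K), ((p : ℕ) : 𝓞 K) ∈ v.asIdeal → ∀ X : Vp W K p,
      resH1Hom (Literature.NumberTheory.EllipticCurves.subgroupIncl (κ.layerSubgroup 0))
          (AddSubgroup.inclusion (geomTorsion_natCast_pow_one W (K := K) (p := p)).le) (fun _ _ ↦ rfl) X ∈
        condAboveTorsion (W.baseChange K) p κ v (.sgn ε) 0 1 →
      X ∈ selmerLocalKer (W.baseChange K) (v.adicCompletion K) ((p ^ 1 : ℕ) : ℤ))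
    (hall : ∀ q : ℕ, q.Prime → q ∣ N → ∃ v' : HeightOneSpectrum (𝓞 ℚ), ((q : ℕ) : 𝓞 ℚ) ∈ v'.asIdeal ∧
      ∃ 𝔓 ∈ v'.primesAbove, ∃ σ ∈ 𝔓.inertia (absoluteGaloisGroup ℚ), ∃ P : W.geomTorsion (p : ℤ), σ • P ≠ P)
    {s : (W.baseChange K).torsionH1Over ((p : ℤ) ^ 1) (κ.layerSubgroup 0)}
    (hs : s ∈ signedOrdSelmerTorsion (W.baseChange K) p κ ε 1 0 1) (hs0 : s ≠ 0)
    (hline : ∀ c ∈ signedOrdSelmerTorsion (W.baseChange K) p κ ε 1 0 1, ∃ a : ℤ, c = a • s)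
    (hNV : B.HasUnitLambda N) : z 0 1 ≠ 0 :=
  limitBaseClass_layer_zero_one_ne_zero_of_hasUnitLambda hB hz hN h5 hsurj hK hH hsp hκ hctrl
    (forall_exists_inertia_smul_ne_baseChange_of_allRamified W hK.1 hN hND hall) hs hs0 hline hNV

end Summit.BirchSwinnertonDyer.BirchSwinnertonDyer.Theorems.SignedBaseChangeAcDivAdmdefHowardRigidityRootAllRamified

end
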